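import Mathlib
import HarnessLib
import Summits.Ventures.LatticeQCDFlow.Scoring.TwoCodeAgreementInProbability
import Summits.Ventures.LatticeQCDFlow.Scoring.AsymptoticCoverage
import Summits.Ventures.LatticeQCDFlow.Scoring.MultivariateDeltaMethod
import Summits.Ventures.LatticeQCDFlow.Scoring.LogRatioAgreementCLT

/-!
# POOLING TWO CODES WITH UNEQUAL, FREELY VARYING SAMPLE SIZES: THE INVERSE-VARIANCE POOLED
# ESTIMATE OF `A` AND `B` IS CALIBRATED — `(m̂ₙ − a)/√V̂ₙ^pool ⇒ N(0,1)`, HENCE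
# `P(|m̂ₙ − a| ≤ z √V̂ₙ^pool) → N(0,1)([−z, z])`

HONEST FRAMING: exact (Metropolis-corrected) sampling algorithms for lattice gauge theory;
figures of merit are autocorrelation/cost numbers at stated couplings and volumes; no
continuum-physics claim.

Venture `LatticeQCDFlow` (cell pub-lqcd), topic `Scoring`; FANOUT row 4 (`s0-u1-b`, GEN-35).
NEW WORK of the cell (classical large-sample statistics; our formalisation), no definition,
nothing cited as a fact (inverse-variance / fixed-effect pooling NAMED ONLY).

WHY (row 4).  The `k`-arm pooling files (`Scoring/KArmPooledEstimate`, …) index every code by the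
same `k`; row 4's two arms were never read at the same sample size.  In the abstract two-code
setting of `Scoring/TwoCodeAgreementInProbability` (same target `a`, `√n(Sₙ^X − a) ⇒ N(0, s_X)`,
`n·V̂ₙ^X → s_X > 0` in PROBABILITY, code `B` read along ANY `mₙ → ∞`, independent runs) the
studentised deviation of the inverse-variance pooled estimate,
`(m̂ₙ − a)/√V̂ₙ^pool = ((Sₙ^A − a)/V̂ₙ^A + (S^B_{mₙ} − a)/V̂^B_{mₙ})/√(1/V̂ₙ^A + 1/V̂^B_{mₙ})`, converges
in distribution to `N(0,1)` (**`twoSample_pooled_clt_of_tendstoInMeasure`**), so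
`P(|m̂ₙ − a| ≤ z·√V̂ₙ^pool) → N(0,1)([−z,z])` (**`twoSample_pooled_coverage`**).  Proof: with
`Uₙ = √n(Sₙ^A − a)`, `Wₙ = √mₙ(S^B_{mₙ} − a)`, the ideal statistic `αₙUₙ + βₙWₙ`
(`αₙ = √n/(s_A Dₙ)`, `βₙ = √mₙ/(s_B Dₙ)`, `Dₙ² = n/s_A + mₙ/s_B`, so `s_Aαₙ² + s_Bβₙ² = 1` whatever
`n/mₙ`) `⇒ N(0,1)` by `Scoring/GaussianCombinationLimit`; using `n·V̂ₙ^X` for `s_X` in the weights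
costs `αₙUₙ(s_A/(nV̂ₙ^A) − 1) + βₙWₙ(…) → 0` in probability (tight × null); the factor
`Dₙ/√(n/(nV̂ₙ^A) + mₙ/(mₙV̂^B_{mₙ})) → 1` in probability (weighted-ratio lemma on the reciprocals);
Slutsky twice; the printed statistic equals the product off an event of vanishing probability.

NOT CLAIMED: conditional calibration given the A-vs-B agreement test (the `k`-arm files do it at
equal `k`); drifts; dependent codes; numbers.
-/

noncomputable section

namespace Summit.Ventures.LatticeQCDFlow.Scoring.CardConsistency

open MeasureTheory ProbabilityTheory Filter Set
open scoped Topology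

/-! ## §1 Two small in-measure lemmas and the algebra -/

section Lemmas

variable {Ω : Type*} [MeasurableSpace Ω] {P : Measure Ω}

/-- A bounded deterministic factor preserves convergence to `0` in measure. [folklore] -/
theorem tendstoInMeasure_zero_const_mul_of_bounded {E : ℕ → Ω → ℝ} {c : ℕ → ℝ} {C : ℝ} (hC : 0 < C)
    (hc : ∀ n, |c n| ≤ C) (hE : TendstoInMeasure P E atTop fun _ => (0 : ℝ)) :
    TendstoInMeasure P (fun n ω => c n * E n ω) atTop fun _ => (0 : ℝ) := by
  rw [tendstoInMeasure_iff_norm] at hE ⊢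
  intro ε hε
  have h := hE (ε / C) (div_pos hε hC)
  refine tendsto_of_tendsto_of_tendsto_of_le_of_le' tendsto_const_nhds h
    (Eventually.of_forall fun n => zero_le) (Eventually.of_forall fun n => ?_)
  refine measure_mono fun ω hω => ?_
  simp only [mem_setOf_eq, sub_zero, Real.norm_eq_abs] at hω ⊢
  rw [div_le_iff₀ hC]
  calc ε ≤ |c n * E n ω| := hω
    _ = |c n| * |E n ω| := abs_mul _ _
    _ ≤ C * |E n ω| := mul_le_mul_of_nonneg_right (hc n) (abs_nonneg _)
    _ = |E n ω| * C := mul_comm _ _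

end Lemmas

section Algebra

/-- **The pooled studentisation identity**: for `n, m ≥ 1`, `s_A, s_B > 0`, `V_A, V_B > 0`, with
`x = n V_A`, `y = m V_B`, `D = √(n/s_A + m/s_B)`, `U = √n (S_A − a)`, `W = √m (S_B − a)`:
`((S_A − a)/V_A + (S_B − a)/V_B)/√(1/V_A + 1/V_B) = ((U√n/x + W√m/y)/D) · (D/√(n/x + m/y))`. [ours] -/
theorem twoSample_pooled_studentise_eq {n m : ℕ} (hn : 1 ≤ n) (hm : 1 ≤ m) {sA sB : ℝ} (hsA : 0 < sA)
    (hsB : 0 < sB) (SA SB a : ℝ) {VA VB : ℝ} (hVA : 0 < VA) (hVB : 0 < VB) :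
    ((SA - a) / VA + (SB - a) / VB) / Real.sqrt (1 / VA + 1 / VB)
      = ((Real.sqrt n * (SA - a) * Real.sqrt n / ((n : ℝ) * VA)
          + Real.sqrt m * (SB - a) * Real.sqrt m / ((m : ℝ) * VB))
          / Real.sqrt ((n : ℝ) / sA + (m : ℝ) / sB))
        * (Real.sqrt ((n : ℝ) / sA + (m : ℝ) / sB)
          / Real.sqrt ((n : ℝ) / ((n : ℝ) * VA) + (m : ℝ) / ((m : ℝ) * VB))) := by
  have hn0 : (0 : ℝ) < n := by exact_mod_cast hn
  have hm0 : (0 : ℝ) < m := by exact_mod_cast hm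
  have hD : 0 < Real.sqrt ((n : ℝ) / sA + (m : ℝ) / sB) :=
    Real.sqrt_pos.2 (add_pos (div_pos hn0 hsA) (div_pos hm0 hsB))
  have e1 : Real.sqrt n * (SA - a) * Real.sqrt n / ((n : ℝ) * VA) = (SA - a) / VA := by
    rw [show Real.sqrt n * (SA - a) * Real.sqrt n = (Real.sqrt n * Real.sqrt n) * (SA - a) by ring,
      Real.mul_self_sqrt hn0.le]
    field_simp
  have e2 : Real.sqrt m * (SB - a) * Real.sqrt m / ((m : ℝ) * VB) = (SB - a) / VB := by
    rw [show Real.sqrt m * (SB - a) * Real.sqrt m = (Real.sqrt m * Real.sqrt m) * (SB - a) by ring,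
      Real.mul_self_sqrt hm0.le]
    field_simp
  have e3 : (n : ℝ) / ((n : ℝ) * VA) + (m : ℝ) / ((m : ℝ) * VB) = 1 / VA + 1 / VB := by
    field_simp
  rw [e1, e2, e3, div_mul_div_comm, mul_comm (Real.sqrt ((n : ℝ) / sA + (m : ℝ) / sB)),
    mul_div_mul_right _ _ hD.ne']

end Algebra

/-! ## §2 The pooled estimate of two codes is calibrated -/

section Pooled

variable {ΩA : Type*} [MeasurableSpace ΩA] {PA : Measure ΩA} [IsProbabilityMeasure PA]
variable {ΩB : Type*} [MeasurableSpace ΩB] {PB : Measure ΩB} [IsProbabilityMeasure PB]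
variable {Ω' : Type*} [MeasurableSpace Ω'] {P' : Measure Ω'} [IsProbabilityMeasure P']

set_option maxHeartbeats 400000 in
/-- **THE POOLED ESTIMATE OF TWO CODES IS CALIBRATED, ANY SAMPLE-SIZE RATIO, IN-MEASURE ERROR BARS.**
Two independent codes with the same target `a`, `√n(Sₙ^X − a) ⇒ N(0, s_X)` (`s_X > 0`),
`n·V̂ₙ^X → s_X` in probability, code `B` read along `mₙ → ∞`.  Then on `P_A ⊗ P_B`
`((Sₙ^A − a)/V̂ₙ^A + (S^B_{mₙ} − a)/V̂^B_{mₙ})/√(1/V̂ₙ^A + 1/V̂^B_{mₙ}) ⇒ Z ∼ N(0,1)` — the studentised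
deviation of the inverse-variance pooled estimate. [ours] -/
theorem twoSample_pooled_clt_of_tendstoInMeasure {SA VA : ℕ → ΩA → ℝ} {SB VB : ℕ → ΩB → ℝ}
    {a sA sB : ℝ} {ZA ZB Z : Ω' → ℝ} (hsA : 0 < sA) (hsB : 0 < sB)
    (hSAm : ∀ n, Measurable (SA n)) (hVAm : ∀ n, Measurable (VA n))
    (hSBm : ∀ n, Measurable (SB n)) (hVBm : ∀ n, Measurable (VB n))
    (hcltA : TendstoInDistribution (fun (n : ℕ) ω => Real.sqrt n * (SA n ω - a)) atTop ZA
      (fun _ => PA) P') (hZA : HasLaw ZA (gaussianReal 0 sA.toNNReal) P')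
    (hcltB : TendstoInDistribution (fun (n : ℕ) ω => Real.sqrt n * (SB n ω - a)) atTop ZB
      (fun _ => PB) P') (hZB : HasLaw ZB (gaussianReal 0 sB.toNNReal) P')
    (hVA : TendstoInMeasure PA (fun (n : ℕ) ω => (n : ℝ) * VA n ω) atTop fun _ => sA)
    (hVB : TendstoInMeasure PB (fun (n : ℕ) ω => (n : ℝ) * VB n ω) atTop fun _ => sB)
    {m : ℕ → ℕ} (hm : Tendsto m atTop atTop) (hZ : HasLaw Z (gaussianReal 0 1) P') :
    TendstoInDistribution (fun (n : ℕ) (ω : ΩA × ΩB) =>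
        ((SA n ω.1 - a) / VA n ω.1 + (SB (m n) ω.2 - a) / VB (m n) ω.2)
          / Real.sqrt (1 / VA n ω.1 + 1 / VB (m n) ω.2))
      atTop Z (fun _ => PA.prod PB) P' := by
  -- Step 1: the scaled columns on the product space and their independence
  have hU : TendstoInDistribution (fun (n : ℕ) (ω : ΩA × ΩB) => Real.sqrt n * (SA n ω.1 - a))
      atTop ZA (fun _ => PA.prod PB) P' :=
    tendstoInDistribution_comp_fst hcltA
  have hW : TendstoInDistribution
      (fun (n : ℕ) (ω : ΩA × ΩB) => Real.sqrt (m n : ℕ) * (SB (m n) ω.2 - a))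
      atTop ZB (fun _ => PA.prod PB) P' :=
    tendstoInDistribution_comp_snd (tendstoInDistribution_comp_tendsto hcltB hm)
  have hUW : ∀ n : ℕ, IndepFun (fun ω : ΩA × ΩB => Real.sqrt n * (SA n ω.1 - a))
      (fun ω : ΩA × ΩB => Real.sqrt (m n : ℕ) * (SB (m n) ω.2 - a)) (PA.prod PB) := fun n =>
    indepFun_prod₀ (((hSAm n).sub_const a).const_mul _).aemeasurable
      (((hSBm (m n)).sub_const a).const_mul _).aemeasurable
  -- Step 2: the deterministic weights `αₙ = √n/(s_A Dₙ)`, `βₙ = √m/(s_B Dₙ)`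
  set D : ℕ → ℝ := fun n => Real.sqrt ((n : ℝ) / sA + ((m n : ℕ) : ℝ) / sB) with hD
  set α : ℕ → ℝ := fun n => Real.sqrt n / (sA * D n) with hα
  set β : ℕ → ℝ := fun n => Real.sqrt (m n : ℕ) / (sB * D n) with hβ
  have hDpos : ∀ n : ℕ, 1 ≤ n → 0 < D n := fun n hn => by
    have hn0 : (0 : ℝ) < n := by exact_mod_cast hn
    exact Real.sqrt_pos.2 (add_pos_of_pos_of_nonneg (div_pos hn0 hsA)
      (div_nonneg (Nat.cast_nonneg _) hsB.le))
  have hnorm' : ∀ n : ℕ, 1 ≤ n → sA * α n ^ 2 + sB * β n ^ 2 = 1 := by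
    intro n hn
    have hn0 : (0 : ℝ) < n := by exact_mod_cast hn
    have hD2 : D n ^ 2 = (n : ℝ) / sA + ((m n : ℕ) : ℝ) / sB :=
      Real.sq_sqrt (add_pos_of_pos_of_nonneg (div_pos hn0 hsA) (div_nonneg (Nat.cast_nonneg _) hsB.le)).le
    have hDn := (hDpos n hn).ne'
    simp only [hα, hβ, div_pow, mul_pow, Real.sq_sqrt hn0.le, Real.sq_sqrt (Nat.cast_nonneg _)]
    rw [hD2]
    field_simp
  have hnorm : ∀ᶠ n : ℕ in atTop, sA * α n ^ 2 + sB * (-β n) ^ 2 = 1 := by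
    filter_upwards [eventually_ge_atTop 1] with n hn
    rw [neg_pow_two]
    exact hnorm' n hn
  have hαb : ∀ n, |α n| ≤ (Real.sqrt sA)⁻¹ := by
    intro n
    rcases Nat.lt_or_ge n 1 with h0 | h1
    · have : n = 0 := by omega
      simp only [hα, this, Nat.cast_zero, Real.sqrt_zero, zero_div, abs_zero]
      positivity
    · have hsq : α n ^ 2 ≤ sA⁻¹ := by
        rw [inv_eq_one_div, le_div_iff₀ hsA]
        nlinarith [hnorm' n h1, sq_nonneg (β n), hsB]
      calc |α n| ≤ Real.sqrt (sA⁻¹) := Real.abs_le_sqrt hsq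
        _ = (Real.sqrt sA)⁻¹ := Real.sqrt_inv sA
  have hβb : ∀ n, |β n| ≤ (Real.sqrt sB)⁻¹ := by
    intro n
    rcases Nat.lt_or_ge n 1 with h0 | h1
    · obtain rfl : n = 0 := by omega
      by_cases hm0 : m 0 = 0
      · simp only [hβ, hm0, Nat.cast_zero, Real.sqrt_zero, zero_div, abs_zero]
        positivity
      · -- `n = 0`: `D 0 = √(m₀/s_B)`, `β 0 = √m₀/(s_B √(m₀/s_B))`, and `s_B β² = 1`
        have hmpos : (0 : ℝ) < (m 0 : ℕ) := by exact_mod_cast Nat.pos_of_ne_zero hm0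
        have hD2 : D 0 ^ 2 = ((m 0 : ℕ) : ℝ) / sB := by
          simp only [hD, Nat.cast_zero, zero_div, zero_add]
          exact Real.sq_sqrt (div_nonneg hmpos.le hsB.le)
        have hsq : β 0 ^ 2 ≤ sB⁻¹ := by
          have : sB * β 0 ^ 2 = 1 := by
            simp only [hβ, div_pow, mul_pow, Real.sq_sqrt hmpos.le]
            rw [hD2]; field_simp
          rw [inv_eq_one_div, le_div_iff₀ hsB]
          nlinarith
        calc |β 0| ≤ Real.sqrt (sB⁻¹) := Real.abs_le_sqrt hsq
          _ = (Real.sqrt sB)⁻¹ := Real.sqrt_inv sB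
    · have hsq : β n ^ 2 ≤ sB⁻¹ := by
        rw [inv_eq_one_div, le_div_iff₀ hsB]
        nlinarith [hnorm' n h1, sq_nonneg (α n), hsA]
      calc |β n| ≤ Real.sqrt (sB⁻¹) := Real.abs_le_sqrt hsq
        _ = (Real.sqrt sB)⁻¹ := Real.sqrt_inv sB
  -- Step 3: the ideal statistic `Lₙ = αₙUₙ + βₙWₙ ⇒ Z`
  have hL := tendstoInDistribution_gaussianCombination hsA hsB hU hZA hW hZB hUW hnorm hZ
  have hL' : TendstoInDistribution (fun (n : ℕ) (ω : ΩA × ΩB) =>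
      α n * (Real.sqrt n * (SA n ω.1 - a)) + β n * (Real.sqrt (m n : ℕ) * (SB (m n) ω.2 - a)))
      atTop Z (fun _ => PA.prod PB) P' := by
    refine hL.congr (fun n => Eventually.of_forall fun ω => ?_) EventuallyEq.rfl
    ring
  -- Step 4: replacing `s_X` by `n V̂ₙ^X` in the weights costs a null sequence
  have hA' : TendstoInMeasure (PA.prod PB) (fun (n : ℕ) (ω : ΩA × ΩB) => (n : ℝ) * VA n ω.1)
      atTop fun _ => sA :=
    tendstoInMeasure_comp_fst hVA
  have hB' : TendstoInMeasure (PA.prod PB)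
      (fun (n : ℕ) (ω : ΩA × ΩB) => ((m n : ℕ) : ℝ) * VB (m n) ω.2) atTop fun _ => sB :=
    tendstoInMeasure_comp_snd (tendstoInMeasure_comp_tendsto hVB hm)
  have hrA : TendstoInMeasure (PA.prod PB)
      (fun (n : ℕ) (ω : ΩA × ΩB) => sA / ((n : ℝ) * VA n ω.1) - 1) atTop fun _ => (0 : ℝ) := by
    have hφ : ContinuousAt (fun r : ℝ => sA / r - 1) sA :=
      ((continuousAt_const.div continuousAt_id hsA.ne').sub continuousAt_const)
    have h := tendstoInMeasure_comp_continuousAt_normed hA' hφ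
    simp only [div_self hsA.ne', sub_self] at h
    exact h
  have hrB : TendstoInMeasure (PA.prod PB)
      (fun (n : ℕ) (ω : ΩA × ΩB) => sB / (((m n : ℕ) : ℝ) * VB (m n) ω.2) - 1) atTop
      fun _ => (0 : ℝ) := by
    have hφ : ContinuousAt (fun r : ℝ => sB / r - 1) sB :=
      ((continuousAt_const.div continuousAt_id hsB.ne').sub continuousAt_const)
    have h := tendstoInMeasure_comp_continuousAt_normed hB' hφ
    simp only [div_self hsB.ne', sub_self] at h
    exact h
  have hrAm : ∀ n : ℕ, Measurable fun ω : ΩA × ΩB => sA / ((n : ℝ) * VA n ω.1) - 1 := fun n =>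
    (measurable_const.div (((hVAm n).comp measurable_fst).const_mul _)).sub_const _
  have hrBm : ∀ n : ℕ, Measurable fun ω : ΩA × ΩB => sB / (((m n : ℕ) : ℝ) * VB (m n) ω.2) - 1 :=
    fun n => (measurable_const.div (((hVBm (m n)).comp measurable_snd).const_mul _)).sub_const _
  have hmulc : Continuous fun p : ℝ × ℝ => p.1 * p.2 := by fun_prop
  have hE1 : TendstoInMeasure (PA.prod PB) (fun (n : ℕ) (ω : ΩA × ΩB) =>
      (Real.sqrt n * (SA n ω.1 - a)) * (sA / ((n : ℝ) * VA n ω.1) - 1)) atTop fun _ => (0 : ℝ) := by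
    have h := hU.continuous_comp_prodMk_of_tendstoInMeasure_const hmulc hrA
      (fun n => (hrAm n).aemeasurable)
    simp only [mul_zero] at h
    exact tendstoInMeasure_of_tendstoInDistribution_const h
  have hE2 : TendstoInMeasure (PA.prod PB) (fun (n : ℕ) (ω : ΩA × ΩB) =>
      (Real.sqrt (m n : ℕ) * (SB (m n) ω.2 - a)) * (sB / (((m n : ℕ) : ℝ) * VB (m n) ω.2) - 1))
      atTop fun _ => (0 : ℝ) := by
    have h := hW.continuous_comp_prodMk_of_tendstoInMeasure_const hmulc hrB
      (fun n => (hrBm n).aemeasurable)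
    simp only [mul_zero] at h
    exact tendstoInMeasure_of_tendstoInDistribution_const h
  have hαE1 := tendstoInMeasure_zero_const_mul_of_bounded (inv_pos.2 (Real.sqrt_pos.2 hsA)) hαb hE1
  have hβE2 := tendstoInMeasure_zero_const_mul_of_bounded (inv_pos.2 (Real.sqrt_pos.2 hsB)) hβb hE2
  have hsumc : ContinuousAt (fun p : ℝ × ℝ => p.1 + p.2) ((0 : ℝ), (0 : ℝ)) := by fun_prop
  have hdev1 := tendstoInMeasure_comp_continuousAt_normed (tendstoInMeasure_prodMk hαE1 hβE2) hsumc
  simp only [add_zero] at hdev1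
  -- the corrected numerator `Nₙ = (Uₙ√n/(nV̂^A) + Wₙ√m/(mV̂^B))/Dₙ ⇒ Z`
  set N : ℕ → ΩA × ΩB → ℝ := fun n ω =>
    (Real.sqrt n * (SA n ω.1 - a) * Real.sqrt n / ((n : ℝ) * VA n ω.1)
      + Real.sqrt (m n : ℕ) * (SB (m n) ω.2 - a) * Real.sqrt (m n : ℕ) / (((m n : ℕ) : ℝ) * VB (m n) ω.2))
      / D n with hN
  have hNm : ∀ n : ℕ, Measurable (N n) := by
    intro n
    have h1 : Measurable fun ω : ΩA × ΩB => SA n ω.1 := (hSAm n).comp measurable_fst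
    have h2 : Measurable fun ω : ΩA × ΩB => VA n ω.1 := (hVAm n).comp measurable_fst
    have h3 : Measurable fun ω : ΩA × ΩB => SB (m n) ω.2 := (hSBm (m n)).comp measurable_snd
    have h4 : Measurable fun ω : ΩA × ΩB => VB (m n) ω.2 := (hVBm (m n)).comp measurable_snd
    simp only [hN]
    fun_prop
  have hNconv : TendstoInDistribution N atTop Z (fun _ => PA.prod PB) P' := by
    refine tendstoInDistribution_of_tendstoInMeasure_sub _ _ hL' ?_ (fun n => (hNm n).aemeasurable)
    refine hdev1.congr' ?_ EventuallyEq.rfl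
    filter_upwards [eventually_ge_atTop 1] with n hn
    refine Eventually.of_forall fun ω => ?_
    have hDn := (hDpos n hn).ne'
    simp only [hN, hα, hβ, Pi.sub_apply]
    field_simp
    ring
  -- Step 5: the overall factor `Dₙ/√(n/(nV̂^A) + m/(mV̂^B)) → 1` in probability
  have hinvA : TendstoInMeasure (PA.prod PB) (fun (n : ℕ) (ω : ΩA × ΩB) => ((n : ℝ) * VA n ω.1)⁻¹)
      atTop fun _ => sA⁻¹ :=
    tendstoInMeasure_comp_continuousAt_normed hA' (continuousAt_inv₀ hsA.ne')
  have hinvB : TendstoInMeasure (PA.prod PB)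
      (fun (n : ℕ) (ω : ΩA × ΩB) => (((m n : ℕ) : ℝ) * VB (m n) ω.2)⁻¹) atTop fun _ => sB⁻¹ :=
    tendstoInMeasure_comp_continuousAt_normed hB' (continuousAt_inv₀ hsB.ne')
  have hpq : ∀ᶠ n : ℕ in atTop, 0 ≤ (n : ℝ) ∧ 0 ≤ ((m n : ℕ) : ℝ) ∧ 0 < (n : ℝ) + ((m n : ℕ) : ℝ) := by
    filter_upwards [eventually_ge_atTop 1] with n hn
    have hn0 : (0 : ℝ) < n := by exact_mod_cast hn
    exact ⟨hn0.le, Nat.cast_nonneg _, add_pos_of_pos_of_nonneg hn0 (Nat.cast_nonneg _)⟩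
  have hR : TendstoInMeasure (PA.prod PB) (fun (n : ℕ) (ω : ΩA × ΩB) =>
      (((n : ℝ) * VA n ω.1)⁻¹ * (n : ℝ) + (((m n : ℕ) : ℝ) * VB (m n) ω.2)⁻¹ * ((m n : ℕ) : ℝ))
        / (sA⁻¹ * (n : ℝ) + sB⁻¹ * ((m n : ℕ) : ℝ))) atTop fun _ => (1 : ℝ) :=
    tendstoInMeasure_weightedRatio_one (inv_pos.2 hsA) (inv_pos.2 hsB) hinvA hinvB hpq
  have hRm : ∀ n : ℕ, Measurable fun ω : ΩA × ΩB =>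
      (((n : ℝ) * VA n ω.1)⁻¹ * (n : ℝ) + (((m n : ℕ) : ℝ) * VB (m n) ω.2)⁻¹ * ((m n : ℕ) : ℝ))
        / (sA⁻¹ * (n : ℝ) + sB⁻¹ * ((m n : ℕ) : ℝ)) := by
    intro n
    have h2 : Measurable fun ω : ΩA × ΩB => VA n ω.1 := (hVAm n).comp measurable_fst
    have h4 : Measurable fun ω : ΩA × ΩB => VB (m n) ω.2 := (hVBm (m n)).comp measurable_snd
    fun_prop
  have hgc : Continuous fun z : ℝ × ℝ => z.1 / Real.sqrt (max z.2 (1 / 2)) :=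
    continuous_fst.div (continuous_snd.max continuous_const).sqrt fun z =>
      (Real.sqrt_pos.2 (lt_max_of_lt_right one_half_pos)).ne'
  have hsl := hNconv.continuous_comp_prodMk_of_tendstoInMeasure_const hgc hR
    (fun n => (hRm n).aemeasurable)
  have elim : (fun ω' => Z ω' / Real.sqrt (max (1 : ℝ) (1 / 2))) = Z := by
    funext ω'
    rw [max_eq_left (by norm_num), Real.sqrt_one, div_one]
  rw [elim] at hsl
  -- Step 6: the printed statistic equals `Nₙ/√(max(Rₙ, 1/2))` off an event of vanishing probability
  have hTm : ∀ n : ℕ, Measurable fun ω : ΩA × ΩB =>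
      ((SA n ω.1 - a) / VA n ω.1 + (SB (m n) ω.2 - a) / VB (m n) ω.2)
        / Real.sqrt (1 / VA n ω.1 + 1 / VB (m n) ω.2) := by
    intro n
    have h1 : Measurable fun ω : ΩA × ΩB => SA n ω.1 := (hSAm n).comp measurable_fst
    have h2 : Measurable fun ω : ΩA × ΩB => VA n ω.1 := (hVAm n).comp measurable_fst
    have h3 : Measurable fun ω : ΩA × ΩB => SB (m n) ω.2 := (hSBm (m n)).comp measurable_snd
    have h4 : Measurable fun ω : ΩA × ΩB => VB (m n) ω.2 := (hVBm (m n)).comp measurable_snd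
    fun_prop
  refine tendstoInDistribution_of_tendstoInMeasure_sub _ _ hsl ?_ (fun n => (hTm n).aemeasurable)
  rw [tendstoInMeasure_iff_norm]
  intro ε hε
  have hR' := (tendstoInMeasure_iff_norm.1 hR) (1 / 2) one_half_pos
  have hVA' := (tendstoInMeasure_iff_norm.1 hA') (sA / 2) (half_pos hsA)
  have hVB' := (tendstoInMeasure_iff_norm.1 hB') (sB / 2) (half_pos hsB)
  have hsum := (hR'.add hVA').add hVB'
  rw [add_zero, add_zero] at hsum
  refine tendsto_of_tendsto_of_tendsto_of_le_of_le' tendsto_const_nhds hsum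
    (Eventually.of_forall fun n => zero_le) ?_
  filter_upwards [eventually_ge_atTop 1, hm.eventually (eventually_ge_atTop 1)] with n hn1 hm1
  refine (measure_mono fun ω hω => ?_).trans ((measure_union_le _ _).trans
    (add_le_add (measure_union_le _ _) le_rfl))
  simp only [Set.mem_setOf_eq, Set.mem_union] at hω ⊢
  by_contra hnone
  push Not at hnone
  obtain ⟨⟨h1, h2⟩, h3⟩ := hnone
  rw [Real.norm_eq_abs, abs_sub_lt_iff] at h1 h2 h3
  have hn0 : (0 : ℝ) < n := by exact_mod_cast hn1
  have hm0 : (0 : ℝ) < (m n : ℕ) := by exact_mod_cast hm1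
  have hVApos : 0 < VA n ω.1 := by
    by_contra hle
    have : (n : ℝ) * VA n ω.1 ≤ 0 := mul_nonpos_of_nonneg_of_nonpos hn0.le (not_lt.1 hle)
    linarith [h2.1, h2.2]
  have hVBpos : 0 < VB (m n) ω.2 := by
    by_contra hle
    have : ((m n : ℕ) : ℝ) * VB (m n) ω.2 ≤ 0 := mul_nonpos_of_nonneg_of_nonpos hm0.le (not_lt.1 hle)
    linarith [h3.1, h3.2]
  have hRge : (1 : ℝ) / 2 ≤ (((n : ℝ) * VA n ω.1)⁻¹ * (n : ℝ)
      + (((m n : ℕ) : ℝ) * VB (m n) ω.2)⁻¹ * ((m n : ℕ) : ℝ)) / (sA⁻¹ * (n : ℝ) + sB⁻¹ * ((m n : ℕ) : ℝ)) := by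
    linarith [h1.1, h1.2]
  -- on the good event the printed statistic IS `Nₙ/√Rₙ`
  have hident : ((SA n ω.1 - a) / VA n ω.1 + (SB (m n) ω.2 - a) / VB (m n) ω.2)
        / Real.sqrt (1 / VA n ω.1 + 1 / VB (m n) ω.2)
      = N n ω / Real.sqrt (max ((((n : ℝ) * VA n ω.1)⁻¹ * (n : ℝ)
          + (((m n : ℕ) : ℝ) * VB (m n) ω.2)⁻¹ * ((m n : ℕ) : ℝ)) / (sA⁻¹ * (n : ℝ) + sB⁻¹ * ((m n : ℕ) : ℝ)))
          (1 / 2)) := by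
    rw [max_eq_left hRge, twoSample_pooled_studentise_eq hn1 hm1 hsA hsB (SA n ω.1) (SB (m n) ω.2) a
      hVApos hVBpos]
    simp only [hN, hD]
    have hQpos : 0 < (n : ℝ) / ((n : ℝ) * VA n ω.1) + ((m n : ℕ) : ℝ) / (((m n : ℕ) : ℝ) * VB (m n) ω.2) :=
      add_pos (div_pos hn0 (mul_pos hn0 hVApos)) (div_pos hm0 (mul_pos hm0 hVBpos))
    have hQ : ((n : ℝ) * VA n ω.1)⁻¹ * (n : ℝ) + (((m n : ℕ) : ℝ) * VB (m n) ω.2)⁻¹ * ((m n : ℕ) : ℝ)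
        = (n : ℝ) / ((n : ℝ) * VA n ω.1) + ((m n : ℕ) : ℝ) / (((m n : ℕ) : ℝ) * VB (m n) ω.2) := by
      rw [div_eq_inv_mul, div_eq_inv_mul]
    have hS : sA⁻¹ * (n : ℝ) + sB⁻¹ * ((m n : ℕ) : ℝ) = (n : ℝ) / sA + ((m n : ℕ) : ℝ) / sB := by
      rw [div_eq_inv_mul, div_eq_inv_mul]
    have key : Real.sqrt ((n : ℝ) / sA + ((m n : ℕ) : ℝ) / sB)
        / Real.sqrt ((n : ℝ) / ((n : ℝ) * VA n ω.1) + ((m n : ℕ) : ℝ) / (((m n : ℕ) : ℝ) * VB (m n) ω.2))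
        = (Real.sqrt ((((n : ℝ) * VA n ω.1)⁻¹ * (n : ℝ)
            + (((m n : ℕ) : ℝ) * VB (m n) ω.2)⁻¹ * ((m n : ℕ) : ℝ)) / (sA⁻¹ * (n : ℝ) + sB⁻¹ * ((m n : ℕ) : ℝ))))⁻¹ := by
      rw [hQ, hS, Real.sqrt_div hQpos.le, inv_div]
    rw [key, ← div_eq_mul_inv]
  rw [Pi.sub_apply, Pi.sub_apply, Pi.zero_apply, sub_zero, hident, sub_self, norm_zero] at hω
  exact absurd hω (not_le.2 hε)

/-- **THE POOLED INTERVAL OF TWO CODES IS CALIBRATED**: same setting, every `z`: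
`P(|(m̂ₙ − a)/√V̂ₙ^pool| ≤ z) → N(0,1)([−z, z])`, i.e. "`|m̂ₙ − a| ≤ z·√V̂ₙ^pool`" read through the
studentised deviation `((Sₙ^A − a)/V̂ₙ^A + (S^B_{mₙ} − a)/V̂^B_{mₙ})/√(1/V̂ₙ^A + 1/V̂^B_{mₙ})`. [ours] -/
theorem twoSample_pooled_coverage {SA VA : ℕ → ΩA → ℝ} {SB VB : ℕ → ΩB → ℝ}
    {a sA sB : ℝ} {ZA ZB Z : Ω' → ℝ} (hsA : 0 < sA) (hsB : 0 < sB)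
    (hSAm : ∀ n, Measurable (SA n)) (hVAm : ∀ n, Measurable (VA n))
    (hSBm : ∀ n, Measurable (SB n)) (hVBm : ∀ n, Measurable (VB n))
    (hcltA : TendstoInDistribution (fun (n : ℕ) ω => Real.sqrt n * (SA n ω - a)) atTop ZA
      (fun _ => PA) P') (hZA : HasLaw ZA (gaussianReal 0 sA.toNNReal) P')
    (hcltB : TendstoInDistribution (fun (n : ℕ) ω => Real.sqrt n * (SB n ω - a)) atTop ZB
      (fun _ => PB) P') (hZB : HasLaw ZB (gaussianReal 0 sB.toNNReal) P')
    (hVA : TendstoInMeasure PA (fun (n : ℕ) ω => (n : ℝ) * VA n ω) atTop fun _ => sA)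
    (hVB : TendstoInMeasure PB (fun (n : ℕ) ω => (n : ℝ) * VB n ω) atTop fun _ => sB)
    {m : ℕ → ℕ} (hm : Tendsto m atTop atTop) (hZ : HasLaw Z (gaussianReal 0 1) P') (z : ℝ) :
    Tendsto (fun n => (PA.prod PB).real {ω : ΩA × ΩB |
        |((SA n ω.1 - a) / VA n ω.1 + (SB (m n) ω.2 - a) / VB (m n) ω.2)
          / Real.sqrt (1 / VA n ω.1 + 1 / VB (m n) ω.2)| ≤ z})
      atTop (𝓝 ((gaussianReal 0 1).real (Icc (-z) z))) :=
  tendsto_measureReal_abs_le_gaussian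
    (twoSample_pooled_clt_of_tendstoInMeasure hsA hsB hSAm hVAm hSBm hVBm hcltA hZA hcltB hZB hVA
      hVB hm hZ) hZ z

end Pooled

end Summit.Ventures.LatticeQCDFlow.Scoring.CardConsistency

end
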